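import Summits.Ventures.CertifiedArithmetic.LowPrec.GemmThetaE2M1Fp16Defs

/-!
# The θ-certificate of E2M1²→binary16: kernel check of the states with index in `[7168, 8192)`

HONEST FRAMING (venture CertifiedArithmetic / cell `pub-lowprec`, seat gemm, gen 10): certified error
envelopes and provably optimal rounding/accumulation schemes for low-precision formats under stated
cost models; every table by two implementations; no hardware or vendor claims.

Part 8 of 9 of the kernel check of the Boolean certificate of `GemmThetaE2M1Fp16Defs.lean`
(paper `gemm.tex` §Regimes Prop. Θ(i), configuration E2M1·E2M1 → `binary16`, sequential, RNE,
saturating model): every edge from the states with index `7168 ≤ i < 8192` (both signs, all 37 letters,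
with the pair checks after free moves) passes `edgeOK`, by `decide +kernel` in chunks of 256 indices
(each chunk = 18,944 edges).  Split into files only to bound each file's kernel time;
`GemmThetaE2M1Fp16.lean` assembles the parts.  See the Defs file for the meaning of the check.
-/

namespace Literature.ComputerArithmetic.FloatingPoint

namespace MiniFloat

namespace ThetaE2M1Fp16

/-- Every edge from the states with index in `[7168, 7424)` (both signs, all 37 letters) passes
`edgeOK`. [cell certificate, kernel-checked] -/
theorem edges_ok_7168 : rowsOK 7168 256 = true := by
  decide +kernel

/-- Every edge from the states with index in `[7424, 7680)` (both signs, all 37 letters) passes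
`edgeOK`. [cell certificate, kernel-checked] -/
theorem edges_ok_7424 : rowsOK 7424 256 = true := by
  decide +kernel

/-- Every edge from the states with index in `[7680, 7936)` (both signs, all 37 letters) passes
`edgeOK`. [cell certificate, kernel-checked] -/
theorem edges_ok_7680 : rowsOK 7680 256 = true := by
  decide +kernel

/-- Every edge from the states with index in `[7936, 8192)` (both signs, all 37 letters) passes
`edgeOK`. [cell certificate, kernel-checked] -/
theorem edges_ok_7936 : rowsOK 7936 256 = true := by
  decide +kernel

/-- PART 8: every edge from the states with index in `[7168, 8192)` passes `edgeOK`.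
[cell certificate, kernel-checked] -/
theorem part_08 : rowsOK 7168 1024 = true :=
  rowsOK_append 7168 256 768 edges_ok_7168 <|
  rowsOK_append 7424 256 512 edges_ok_7424 <|
  rowsOK_append 7680 256 256 edges_ok_7680 <|
  edges_ok_7936

end ThetaE2M1Fp16

end MiniFloat

end Literature.ComputerArithmetic.FloatingPoint
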